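import Literature.NumberTheory.EllipticCurves.ModularSymbolsHeckeProofs
import Literature.NumberTheory.EllipticCurves.HeckeOperatorsGamma1QExpansionProofs
import Mathlib.Analysis.Fourier.ZMod
import HarnessLib

/-!
# Periodic twists (cuts) of integral-weight modular forms

For a modular form `f = ∑ cₙ qⁿ` of integral weight `k` on `Γ₁(L)` and ANY function
`a : ℤ/Qℤ → ℂ` (`Q ≥ 1`), the series `∑ a(n mod Q) cₙ qⁿ` is again (the `q`-expansion of) a
modular form of weight `k`, on `Γ₁(L Q²)`. Special cases: the twist by a Dirichlet character
mod `Q` (Shimura 1971, Prop. 3.64, where `f_χ = g(χ̄)⁻¹ ∑_u χ̄(u) f(τ + u/Q)`; Koblitz 1993,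
Ch. III §3, Prop. 17, same construction for `M_k(Γ₀(M), χ')`), and the **cut** of `f` along a
set `S` of residues mod `Q` (`a = 𝟙_S`), including residue classes NOT coprime to `Q`, which
character twists alone do not reach; both follow from the same finite Fourier analysis of the
translates `f(τ + j/Q)`, which is what is formalised here.

Proof (Shimura, loc. cit.): `F' = ∑_{j mod Q} b(j) · f(τ + j/Q)` with `b = Q⁻¹ · 𝓕a` the finite
Fourier transform (Mathlib `ZMod.dft`); each translate `f ∣[k] [1, j/Q; 0, 1]` is a modular
form on `[1, -j/Q; 0, 1] Γ₁(L) [1, j/Q; 0, 1] ⊇ Γ₁(L Q²)` (Mathlib `ModularForm.translate` +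
`gamma1_mul_sq_le_conj_upperRightHom`), its `q`-expansion is `∑ e^{2πi nj/Q} cₙ qⁿ`, and Fourier
inversion on `ℤ/Qℤ` gives `∑_j b(j) e^{2πinj/Q} = a(n)`; the coefficients are identified by
Mathlib's uniqueness of `q`-expansions (`ModularFormClass.qExpansion_coeff_unique`).

The tree already has the CUSP-form character twist on `Γ₀(N)`
(`Literature.NumberTheory.EllipticCurves.CuspFormTwist`, `CuspFormTwistGamma1`); this file is
the `ModularForm`/arbitrary-periodic-multiplier version, stated in Mathlib currency
(`ModularForm (Gamma1 L) k`, `UpperHalfPlane.qExpansion 1`). Main results (namespace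
`Literature.NumberTheory.ModularForms.PeriodicTwist`):

* `exists_modularForm_coe_eq_slash_upperRightHom` — the translate `τ ↦ f(x + τ)` as a modular
  form on any `Γ' ≤ [1,-x;0,1] Γ [1,x;0,1]`;
* `hasSum_slash_upperRightHom` — its `q`-expansion `∑ e^{2πixn} cₙ qⁿ`;
* `gamma1_mul_sq_le_conj_upperRightHom` — `Γ₁(L Q²) ≤ [1,-j/Q;0,1] Γ₁(L) [1,j/Q;0,1]`;
* `exists_modularForm_qExpansion_coeff_eq_mul` — the general periodic twist for a pair
  `Γ' ≤ Γ` of levels; `exists_modularForm_gamma1_qExpansion_coeff_eq_mul` — the `Γ₁(L) → Γ₁(LQ²)`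
  version; `…_eq_mul_of_periodic` (multiplier a `Q`-periodic `c : ℕ → ℂ`) and
  `exists_modularForm_gamma1_qExpansion_coeff_eq_ite` (the cut along a set of residues).

Everything is proved; no definitions, no named facts.

## References

* G. Shimura, *Introduction to the arithmetic theory of automorphic functions*, Iwanami Shoten /
  Princeton UP 1971, Prop. 3.64.
* N. Koblitz, *Introduction to elliptic curves and modular forms*, 2nd ed., GTM 97, Springer 1993,
  Ch. III §3, Prop. 17 (twist `f_χ ∈ M_k(M N², χ'χ²)` via the translates `f(z + j/N)`).
  [KoblitzECMF1993]
-/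

noncomputable section

open scoped MatrixGroups ModularForm Real

open CongruenceSubgroup UpperHalfPlane Complex Matrix.GeneralLinearGroup Matrix.SpecialLinearGroup
  ConjAct Pointwise Function

namespace Literature.NumberTheory.ModularForms

namespace PeriodicTwist

open Literature.NumberTheory.EllipticCurves.ModularForms (slash_upperRightHom_apply qParam_vadd)
open Literature.NumberTheory.EllipticCurves.ModularForms.HeckeTGamma1 (one_mem_strictPeriods_Gamma1)

variable {Γ Γ' : Subgroup (GL (Fin 2) ℝ)} {k : ℤ}

/-! ### Translates of a modular form as modular forms on a smaller group -/

/-- For `Γ' ≤ [1, -x; 0, 1] Γ [1, x; 0, 1]`, the translate `τ ↦ f(x + τ)` (`= f ∣[k] [1, x; 0, 1]`)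
of a modular form `f` of weight `k` on `Γ` is a modular form of weight `k` on `Γ'`: Mathlib's
`ModularForm.translate` (a form on the conjugate group; holomorphy and boundedness at ALL cusps)
restricted to the subgroup `Γ'`, whose cusps are cusps of the conjugate (`IsCusp.mono`)
(Shimura 1971, proof of Prop. 3.64: "`f(z + u/r)` is a modular form for `αΓα⁻¹ ∩ …`").
[cite: Shimura1971, Prop. 3.64] -/
theorem exists_modularForm_coe_eq_slash_upperRightHom (f : ModularForm Γ k) (x : ℝ)
    (hle : Γ' ≤ toConjAct (upperRightHom x : GL (Fin 2) ℝ)⁻¹ • Γ) :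
    ∃ g : ModularForm Γ' k,
      (⇑g : ℍ → ℂ) = (⇑f : ℍ → ℂ) ∣[k] (upperRightHom x : GL (Fin 2) ℝ) :=
  ⟨{ toFun := (⇑f : ℍ → ℂ) ∣[k] (upperRightHom x : GL (Fin 2) ℝ)
     slash_action_eq' := fun γ hγ ↦
       SlashInvariantFormClass.slash_action_eq (ModularForm.translate f (upperRightHom x)) γ
         (hle hγ)
     holo' := ModularFormClass.holo (ModularForm.translate f (upperRightHom x))
     bdd_at_cusps' := fun hc ↦
       ModularFormClass.bdd_at_cusps (ModularForm.translate f (upperRightHom x))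
         (IsCusp.mono hle hc) }, rfl⟩

/-- The `q`-expansion of the translate: if `1` is a strict period of `Γ` and `f = ∑ cₙ qⁿ`
(`q = e^{2πiτ}`), then `f(x + τ) = ∑ e^{2πixn} cₙ qⁿ` (Shimura 1971, proof of Prop. 3.64).
[cite: Shimura1971, Prop. 3.64] -/
theorem hasSum_slash_upperRightHom (hΓ : (1 : ℝ) ∈ Γ.strictPeriods) (f : ModularForm Γ k)
    (x : ℝ) (τ : ℍ) :
    HasSum (fun m : ℕ ↦ (cexp (2 * π * Complex.I * x * m) * (qExpansion 1 f).coeff m) •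
        Periodic.qParam 1 (τ : ℂ) ^ m)
      (((⇑f : ℍ → ℂ) ∣[k] (upperRightHom x : GL (Fin 2) ℝ)) τ) := by
  haveI : Fact (IsCusp OnePoint.infty Γ) := ⟨Γ.isCusp_of_mem_strictPeriods one_pos hΓ⟩
  have h := UpperHalfPlane.hasSum_qExpansion one_pos
    (SlashInvariantFormClass.periodic_comp_ofComplex f hΓ) (ModularFormClass.holo f)
    (ModularFormClass.bdd_at_infty f) (x +ᵥ τ)
  rw [slash_upperRightHom_apply]
  convert h using 2 with m
  rw [qParam_vadd, mul_pow, smul_eq_mul, smul_eq_mul, ← Complex.exp_nat_mul]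
  ring_nf

/-- `e^{2πi (j/Q) m} = ψ(j m)` for the standard additive character `ψ` of `ℤ/Qℤ`
(`ZMod.stdAddChar`). [folklore] -/
private theorem cexp_val_div_mul_eq_stdAddChar {Q : ℕ} [NeZero Q] (j : ZMod Q) (m : ℕ) :
    cexp (2 * π * Complex.I * ((j.val : ℝ) / Q : ℝ) * m) = ZMod.stdAddChar (j * (m : ZMod Q)) := by
  have : j * (m : ZMod Q) = (((j.val * m : ℕ) : ℤ) : ZMod Q) := by
    push_cast
    rw [ZMod.natCast_zmod_val]
  rw [this, ZMod.stdAddChar_coe]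
  push_cast
  ring_nf

/-- **Fourier inversion on `ℤ/Qℤ`** in the form used for twisting: with `b = Q⁻¹ • 𝓕a`,
`∑_j b(j) ψ(j n) = a(n)` (Mathlib `ZMod.dft`, `ZMod.invDFT_apply`). [folklore] -/
private theorem sum_inv_smul_dft_mul_stdAddChar {Q : ℕ} [NeZero Q] (a : ZMod Q → ℂ) (n : ZMod Q) :
    ∑ j : ZMod Q, ((Q : ℂ)⁻¹ • ZMod.dft a) j * ZMod.stdAddChar (j * n) = a n := by
  have hQ : (Q : ℂ) ≠ 0 := Nat.cast_ne_zero.mpr (NeZero.ne Q)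
  have h1 := ZMod.invDFT_apply ((Q : ℂ)⁻¹ • ZMod.dft a) n
  rw [LinearEquiv.map_smul, LinearEquiv.symm_apply_apply, Pi.smul_apply, smul_eq_mul,
    smul_eq_mul] at h1
  have h2 := congrArg (fun z : ℂ ↦ (Q : ℂ) * z) h1
  simp only [← mul_assoc, mul_inv_cancel₀ hQ, one_mul] at h2
  rw [h2]
  exact Finset.sum_congr rfl fun j _ ↦ by rw [smul_eq_mul, mul_comm]

/-! ### The general periodic twist -/

/-- **Periodic twist of a modular form** (general levels). Assume `1` is a strict period of
`Γ` and of `Γ'`, `Γ' ⊆ SL(2, ℝ)`, and `Γ' ≤ [1, -j/Q; 0, 1] Γ [1, j/Q; 0, 1]` for every `j mod Q`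
(`j` represented in `[0, Q)`). Then for every modular form `f = ∑ cₙ qⁿ` of weight `k` on `Γ` and
every `a : ℤ/Qℤ → ℂ` there is a modular form of weight `k` on `Γ'` with `q`-expansion
`∑ a(n) cₙ qⁿ`, namely `∑_{j mod Q} (Q⁻¹ 𝓕a)(j) · f(τ + j/Q)` (Shimura 1971, Prop. 3.64;
Koblitz 1993, III §3 Prop. 17). [cite: Shimura1971, Prop. 3.64] -/
theorem exists_modularForm_qExpansion_coeff_eq_mul (Q : ℕ) [NeZero Q] [Γ'.HasDetOne]
    (hΓ : (1 : ℝ) ∈ Γ.strictPeriods) (hΓ' : (1 : ℝ) ∈ Γ'.strictPeriods)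
    (hle : ∀ j : ZMod Q, Γ' ≤ toConjAct (upperRightHom ((j.val : ℝ) / Q) : GL (Fin 2) ℝ)⁻¹ • Γ)
    (f : ModularForm Γ k) (a : ZMod Q → ℂ) :
    ∃ g : ModularForm Γ' k,
      ∀ n : ℕ, (qExpansion 1 g).coeff n = a n * (qExpansion 1 f).coeff n := by
  choose g hg using fun j : ZMod Q ↦
    exists_modularForm_coe_eq_slash_upperRightHom f ((j.val : ℝ) / Q) (hle j)
  obtain ⟨b, hb⟩ : ∃ b : ZMod Q → ℂ,
      ∀ n : ZMod Q, ∑ j : ZMod Q, b j * ZMod.stdAddChar (j * n) = a n :=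
    ⟨_, sum_inv_smul_dft_mul_stdAddChar a⟩
  refine ⟨∑ j : ZMod Q, b j • g j, fun n ↦ ?_⟩
  have hcoe : (⇑(∑ j : ZMod Q, b j • g j) : ℍ → ℂ) = ∑ j : ZMod Q, b j • (⇑(g j) : ℍ → ℂ) :=
    map_sum (ModularForm.coeHom (Γ := Γ') (k := k)) (fun j ↦ b j • g j) Finset.univ
  have hsum : ∀ τ : ℍ, HasSum (fun m : ℕ ↦ (a m * (qExpansion 1 f).coeff m) •
      Periodic.qParam 1 (τ : ℂ) ^ m) ((∑ j : ZMod Q, b j • g j) τ) := by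
    intro τ
    have hj : ∀ j ∈ (Finset.univ : Finset (ZMod Q)), HasSum (fun m : ℕ ↦ b j *
        ((ZMod.stdAddChar (j * (m : ZMod Q)) * (qExpansion 1 f).coeff m) •
          Periodic.qParam 1 (τ : ℂ) ^ m)) (b j * g j τ) := by
      intro j _
      have h := hasSum_slash_upperRightHom hΓ f ((j.val : ℝ) / Q) τ
      simp only [cexp_val_div_mul_eq_stdAddChar] at h
      have h2 := h.mul_left (b j)
      rwa [← hg j] at h2
    have h := hasSum_sum hj
    rw [hcoe, Finset.sum_apply]
    convert h using 1
    · funext m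
      simp only [smul_eq_mul]
      rw [← hb (m : ZMod Q), Finset.sum_mul, Finset.sum_mul]
      exact Finset.sum_congr rfl fun j _ ↦ by ring
    · exact Finset.sum_congr rfl fun j _ ↦ rfl
  exact (ModularFormClass.qExpansion_coeff_unique one_pos hΓ' hsum n).symm

/-! ### `Γ₁(L Q²)` is contained in every conjugate `[1, -j/Q; 0, 1] Γ₁(L) [1, j/Q; 0, 1]` -/

/-- **The conjugation behind twisting on `Γ₁`**: for `γ = (a b; c d) ∈ Γ₁(L Q²)` and `j ∈ ℕ`,
`[1, j/Q; 0, 1] γ [1, -j/Q; 0, 1] = (a + jc/Q, b + j(d - a)/Q - j²c/Q²; c, d - jc/Q)` is an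
INTEGRAL matrix lying in `Γ₁(L)` (`Q² ∣ c`, `L Q ∣ c`, `Q ∣ d - a`, `a ≡ d ≡ 1 (mod L)`); hence
`Γ₁(L Q²) ≤ [1, -j/Q; 0, 1] Γ₁(L) [1, j/Q; 0, 1]` as subgroups of `GL(2, ℝ)`
(Shimura 1971, proof of Prop. 3.64; Koblitz 1993, III §3 Prop. 17). [cite: Shimura1971, Prop. 3.64] -/
theorem gamma1_mul_sq_le_conj_upperRightHom (L Q : ℕ) [NeZero L] [NeZero Q] (j : ℕ) :
    ((Gamma1 (L * Q ^ 2) : Subgroup SL(2, ℤ)) : Subgroup (GL (Fin 2) ℝ)) ≤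
      toConjAct (upperRightHom ((j : ℝ) / Q) : GL (Fin 2) ℝ)⁻¹ •
        ((Gamma1 L : Subgroup SL(2, ℤ)) : Subgroup (GL (Fin 2) ℝ)) := by
  rintro _ ⟨x, hx, rfl⟩
  haveI : NeZero (L * Q ^ 2) := ⟨mul_ne_zero (NeZero.ne L) (pow_ne_zero 2 (NeZero.ne Q))⟩
  have hx' := (Gamma1_mem (L * Q ^ 2) x).mp hx
  have h00 : ((L * Q ^ 2 : ℕ) : ℤ) ∣ x 0 0 - 1 := by
    rw [← ZMod.intCast_zmod_eq_zero_iff_dvd]; push_cast; rw [hx'.1, sub_self]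
  have h11 : ((L * Q ^ 2 : ℕ) : ℤ) ∣ x 1 1 - 1 := by
    rw [← ZMod.intCast_zmod_eq_zero_iff_dvd]; push_cast; rw [hx'.2.1, sub_self]
  have h10 : ((L * Q ^ 2 : ℕ) : ℤ) ∣ x 1 0 := by
    rw [← ZMod.intCast_zmod_eq_zero_iff_dvd]; exact hx'.2.2
  obtain ⟨a', ha⟩ := h00
  obtain ⟨d', hd⟩ := h11
  obtain ⟨c', hc⟩ := h10
  push_cast at ha hd hc
  have ha' : x 0 0 = 1 + L * Q ^ 2 * a' := by linear_combination ha
  have hd' : x 1 1 = 1 + L * Q ^ 2 * d' := by linear_combination hd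
  have hdet : x 0 0 * x 1 1 - x 0 1 * x 1 0 = 1 := by
    have := Matrix.det_fin_two (x : Matrix (Fin 2) (Fin 2) ℤ)
    rw [Matrix.SpecialLinearGroup.det_coe] at this
    linear_combination -this
  -- the conjugated matrix
  let A : Matrix (Fin 2) (Fin 2) ℤ :=
    !![1 + L * (Q ^ 2 * a' + j * Q * c'), x 0 1 + j * L * Q * (d' - a') - j ^ 2 * L * c';
      L * (Q ^ 2 * c'), 1 + L * (Q ^ 2 * d' - j * Q * c')]
  have hA : A.det = 1 := by
    rw [Matrix.det_fin_two_of]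
    rw [ha', hd', hc] at hdet
    linear_combination hdet
  let y : SL(2, ℤ) := ⟨A, hA⟩
  have hy : y ∈ Gamma1 L := by
    rw [Gamma1_mem]
    refine ⟨?_, ?_, ?_⟩
    · change ((A 0 0 : ℤ) : ZMod L) = 1
      simp [A]
    · change ((A 1 1 : ℤ) : ZMod L) = 1
      simp [A]
    · change ((A 1 0 : ℤ) : ZMod L) = 0
      simp [A]
  rw [map_inv, Subgroup.mem_inv_pointwise_smul_iff, toConjAct_smul]
  refine ⟨y, hy, ?_⟩
  rw [eq_mul_inv_iff_mul_eq]
  have hQ : (Q : ℝ) ≠ 0 := Nat.cast_ne_zero.mpr (NeZero.ne Q)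
  have haR : ((x 0 0 : ℤ) : ℝ) = 1 + L * Q ^ 2 * a' := by exact_mod_cast ha'
  have hdR : ((x 1 1 : ℤ) : ℝ) = 1 + L * Q ^ 2 * d' := by exact_mod_cast hd'
  have hcR : ((x 1 0 : ℤ) : ℝ) = L * Q ^ 2 * c' := by exact_mod_cast hc
  refine Units.ext ?_
  ext i hi
  fin_cases i <;> fin_cases hi <;>
    simp [Matrix.mul_apply, Fin.sum_univ_two, y, A, upperRightHom, haR, hdR, hcR] <;>
    field_simp <;> ring

/-! ### The twist / cut on `Γ₁(L) → Γ₁(L Q²)` -/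

/-- **Periodic twist of a modular form on `Γ₁(L)`**: for `f = ∑ cₙ qⁿ ∈ M_k(Γ₁(L))` and any
`a : ℤ/Qℤ → ℂ`, `Q ≥ 1`, there is `F' ∈ M_k(Γ₁(L Q²))` with `q`-expansion `∑ a(n) cₙ qⁿ`
(Shimura 1971, Prop. 3.64; Koblitz 1993, III §3 Prop. 17). [cite: Shimura1971, Prop. 3.64] -/
theorem exists_modularForm_gamma1_qExpansion_coeff_eq_mul {L : ℕ} [NeZero L] (Q : ℕ)
    [NeZero Q] (f : ModularForm (Gamma1 L) k) (a : ZMod Q → ℂ) :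
    ∃ g : ModularForm (Gamma1 (L * Q ^ 2)) k,
      ∀ n : ℕ, (qExpansion 1 g).coeff n = a n * (qExpansion 1 f).coeff n :=
  exists_modularForm_qExpansion_coeff_eq_mul Q (one_mem_strictPeriods_Gamma1 L)
    (one_mem_strictPeriods_Gamma1 (L * Q ^ 2))
    (fun j ↦ gamma1_mul_sq_le_conj_upperRightHom L Q j.val) f a

/-- Periodic twist, multiplier given as a `Q`-periodic function `c : ℕ → ℂ`: there is
`F' ∈ M_k(Γ₁(L Q²))` with `q`-expansion `∑ c(n) cₙ(f) qⁿ` (the construction of Shimura 1971,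
Prop. 3.64 / Koblitz 1993, III §3 Prop. 17 with an arbitrary periodic multiplier in place of a
character). [cite: Shimura1971, Prop. 3.64] -/
theorem exists_modularForm_gamma1_qExpansion_coeff_eq_mul_of_periodic {L : ℕ} [NeZero L]
    {Q : ℕ} [NeZero Q] (f : ModularForm (Gamma1 L) k) {c : ℕ → ℂ} (hc : Periodic c Q) :
    ∃ g : ModularForm (Gamma1 (L * Q ^ 2)) k,
      ∀ n : ℕ, (qExpansion 1 g).coeff n = c n * (qExpansion 1 f).coeff n := by
  obtain ⟨g, hg⟩ := exists_modularForm_gamma1_qExpansion_coeff_eq_mul Q f fun j ↦ c j.val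
  refine ⟨g, fun n ↦ ?_⟩
  simp only [hg n, ZMod.val_natCast, hc.map_mod_nat]

/-- **The cut of a modular form along residue classes**: for `f = ∑ cₙ qⁿ ∈ M_k(Γ₁(L))` and a
set `S` of residues mod `Q`, `∑_{n mod Q ∈ S} cₙ qⁿ` is the `q`-expansion of a modular form in
`M_k(Γ₁(L Q²))` (the construction of Shimura 1971, Prop. 3.64 / Koblitz 1993, III §3 Prop. 17
with the multiplier `𝟙_S`; no coprimality of the residues to `Q` is needed).
[cite: Shimura1971, Prop. 3.64] -/
theorem exists_modularForm_gamma1_qExpansion_coeff_eq_ite {L : ℕ} [NeZero L] (Q : ℕ)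
    [NeZero Q] (f : ModularForm (Gamma1 L) k) (S : Set (ZMod Q)) [DecidablePred (· ∈ S)] :
    ∃ g : ModularForm (Gamma1 (L * Q ^ 2)) k,
      ∀ n : ℕ, (qExpansion 1 g).coeff n =
        if (n : ZMod Q) ∈ S then (qExpansion 1 f).coeff n else 0 := by
  obtain ⟨g, hg⟩ := exists_modularForm_gamma1_qExpansion_coeff_eq_mul Q f
    fun j ↦ if j ∈ S then 1 else 0
  refine ⟨g, fun n ↦ ?_⟩
  simp only [hg n]
  split_ifs <;> simp

end PeriodicTwist

end Literature.NumberTheory.ModularForms
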